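import Mathlib
import Summits.ResolutionOfSingularities.ResolutionOfSingularities.Theorems.WildQuotientsWildQuotientResolutionToricExitJordanFourBricks
import Summits.ResolutionOfSingularities.ResolutionOfSingularities.Theorems.WildQuotientsWildQuotientResolutionBlowupExitVertexPresentation
import Summits.ResolutionOfSingularities.ResolutionOfSingularities.Theorems.WildQuotientsWildQuotientResolutionJordanFourChart0Sections
import Summits.ResolutionOfSingularities.ResolutionOfSingularities.Theorems.WildQuotientsWildQuotientResolutionJordanFourChart0VertexIdeal
import Summits.ResolutionOfSingularities.ResolutionOfSingularities.Theorems.WildQuotientsWildQuotientResolutionThird112Blowup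
import Summits.ResolutionOfSingularities.ResolutionOfSingularities.Theorems.WildQuotientsWildQuotientResolutionJordanFourBrickH0Prelims

/-!
# V4U piece 0, ring brick `H₀` (3/3): the `μ₃` ring brick of the J₄ toric exit

(crux stmt-ResolutionOfSingularities-15640 `WildQuotients.WildQuotientResolution`, line `Sketch`;
programme V4U of `L/w45c/CHAIN.md` v7.5 §4, RULING v7.5 / CORRECTION 2026-08-27T06:30:44Z
«H₀ = res-type-087». [OURS · L1 W4.5c] — NOT a statement of any manuscript. Prover res-type-087.)

`JordanFour.brickH0` = the `H` hypothesis of `BlowupExit.exists_isBlowup_regular_of_vertexPresentation`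
(p505172) at «`u := ι₀(x_a²)`, `κ := {j ≠ 0}`, `y j := ι₀ (I₆ j)`, `F₀ := {X a, X b, X c}`, `O := O₀`»,
inside the binders `ρ hρ ρB hρB O₀ hO₀` of the brick `HP₀` of p501160: for the chart ratios `T_j`
on `V[x_a²] ⊆ Bl_{I₆} 𝔸ⁿ` there are `R₀ := k[Y] ⧸ ker (Third112.presentation …)` (slot order `(a,b,c)`
for `p ≡ 1`, `(b,c,a)` for `p ≡ 2 (mod 3)`), its vertex ideal `J₀`, and `ψ : R₀ → Γ(O₀)` injective with
`range ψ = Γ(O₀)^G`, `J₀` radical, `Bl_{J₀}` regular (`Third112.blowup_regular`, p498815),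
`√(ψ⁻¹⟨π^*x_a, π^*x_b, π^*x_c, T_j⟩) = J₀`. Assembly: `E : Γ(O₀) ≅ Γ(V, V[x_a²]) ≅ S₀`
(`ι_appLE_eq_topIso_inv`, file 1/3); EQUIVARIANCE `E ∘ act_σ = σ_U ∘ E` checked on generators
(`ActionOver.act_restrict_top_appLE`, `ToricExit.appLE_appLE_of_comp_eq`,
`ToricExit.specAction_appTop_ΓSpecIso_inv_smul`, chart ratios, `aeval_root0_comp_eq`); invariants of the
cyclic `G` = fixed points of the generator = stub-1's `chart0_fixedPoints_eq_map_subst0_*`; the radical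
identity from file 2/3.
-/

-- single-problem summit: the doubled namespace component `ResolutionOfSingularities` is forced
set_option linter.dupNamespace false

noncomputable section

open CategoryTheory AlgebraicGeometry TopologicalSpace MvPolynomial
open Literature.AlgebraicGeometry.Resolution Literature.AlgebraicGeometry.RelativeSpec

namespace Summit.ResolutionOfSingularities.ResolutionOfSingularities.Theorems.WildQuotientResolution.JordanFour


section Chart0

variable (k : Type) [Field k] (n : ℕ) (a b c : Fin n)

/-- The eight generators of `I₆` (vector literal of record). -/
local notation3 "g8" => (![X a ^ 2, X a * X b ^ 2, X a * X b * X c, X a * X c ^ 3, X b ^ 3,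
  X b ^ 2 * X c ^ 2, X b * X c ^ 4, X c ^ 6] : Fin 8 → MvPolynomial (Fin n) k)
/-- The chart quotients `q_j` of record. -/
local notation3 "q8" => (![1, X a * X b ^ 2, X b * X c, X c ^ 3, X b ^ 3, X b ^ 2 * X c ^ 2,
  X b * X c ^ 4, X c ^ 6] : Fin 8 → MvPolynomial (Fin n) k)
/-- The root substitution of record `ψ₀`. -/
local notation3 "root0" => (fun s : Fin n => (if s = a then X a ^ 3 else
  X s * X a ^ (if s = b then 2 else if s = c then 1 else 0) : MvPolynomial (Fin n) k))
/-- The chart-`0` subring `S₀ ⊆ k[x]` of record. -/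
local notation3 "S₀" => Algebra.adjoin k
  (Set.range (fun s : Fin n => MvPolynomial.aeval root0 (X s : MvPolynomial (Fin n) k)) ∪
    Set.range q8)
/-- The ideal `I₆`. -/
local notation3 "I6" => Ideal.span (Set.range g8)
/-- `k[x] → Γ(Spec k[x], ⊤)`. -/
local notation3 "ι₀" => (Scheme.ΓSpecIso (CommRingCat.of (MvPolynomial (Fin n) k))).inv.hom
/-- The `μ₃` vertex chart `V[x_a²]`. -/
local notation3 "Vu" => blowupChart (affineBlowup.π I6) (affineBlowup.idealSheaf I6)
  ⟨⊤, isAffineOpen_top _⟩ (ι₀ (X a ^ 2))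
/-- `V[x_a²] ≤ π⁻¹ ⊤`. -/
local notation3 "hVu" => blowupChart_le_preimage (affineBlowup.π I6) (affineBlowup.idealSheaf I6)
  ⟨⊤, isAffineOpen_top _⟩ (ι₀ (X a ^ 2))

-- large chart / quotient-piece terms: the statement alone elaborates in ≈ 10⁶ heartbeats, and every
-- rewrite under them is costly; the budget is for the whole assembly
set_option maxHeartbeats 40000000 in
set_option synthInstance.maxHeartbeats 400000 in
/-- **The `μ₃` ring brick `H₀` of the J₄ toric exit** (hypothesis `H` of p505172 at
«`u := ι₀(x_a²)`, `κ := {j ≠ 0}`, `y j := ι₀ (I₆ j)`, `F₀ := {X a, X b, X c}`, `O := O₀`», inside the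
binders of `HP₀` of p501160): see the module docstring. [OURS · L1 W4.5c] [assembly of landed decls] -/
theorem brickH0 (p : ℕ) (hp : p.Prime) (hp5 : 5 ≤ p) [CharP k p]
    (σ : MvPolynomial (Fin n) k ≃ₐ[k] MvPolynomial (Fin n) k) [Finite ↥(Subgroup.zpowers σ)]
    (d : Fin n) (hab : a ≠ b) (hac : a ≠ c) (had : a ≠ d) (hbc : b ≠ c) (hbd : b ≠ d) (hcd : c ≠ d)
    (hb : σ (X b) = X b + X a) (hc : σ (X c) = X c + X b) (hd : σ (X d) = X d + X c)
    (hσ : ∀ i, i ≠ b → i ≠ c → i ≠ d → σ (X i) = X i)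
    (ρ : ↥(Subgroup.zpowers σ) →* Aut (Spec (CommRingCat.of (MvPolynomial (Fin n) k))))
    (hρ : ∀ g : ↥(Subgroup.zpowers σ), (ρ g).hom = Spec.map (CommRingCat.ofHom
      ((MulSemiringAction.toRingEquiv (↥(Subgroup.zpowers σ)) (MvPolynomial (Fin n) k) g⁻¹ :
        MvPolynomial (Fin n) k ≃+* MvPolynomial (Fin n) k) :
          MvPolynomial (Fin n) k →+* MvPolynomial (Fin n) k)))
    (ρB : ActionOver (affineBlowup.π I6 ≫ Spec.map (CommRingCat.ofHom (algebraMap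
        (FixedPoints.subalgebra k (MvPolynomial (Fin n) k) (Subgroup.zpowers σ))
        (MvPolynomial (Fin n) k)))) ↥(Subgroup.zpowers σ))
    (hρB : ρB.aut = (affineBlowup.isBlowup I6).liftAction ρ
      (idealSheaf_I6_comap k n σ a b c (hσ a hab hac had) hb hc ρ hρ))
    (O₀ : ρB.StableAffineOpens) (hO₀ : O₀.1 = Vu)
    (hle : ((O₀.1.ι ≫ affineBlowup.π I6 ≫ Spec.map (CommRingCat.ofHom (algebraMap
        (FixedPoints.subalgebra k (MvPolynomial (Fin n) k) (Subgroup.zpowers σ))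
        (MvPolynomial (Fin n) k)))) ⁻¹ᵁ ⊤ : (O₀.1 : Scheme.{0}).Opens) ≤ O₀.1.ι ⁻¹ᵁ Vu)
    (T : {j : Fin 8 // j ≠ 0} → Γ(affineBlowup I6, Vu))
    (hT : ∀ j, (affineBlowup.π I6).appLE ⊤ Vu hVu (ι₀ (g8 j.1)) =
      (affineBlowup.π I6).appLE ⊤ Vu hVu (ι₀ (X a ^ 2)) * T j) :
    ∃ (R₀ : Type) (_ : CommRing R₀) (J₀ : Ideal R₀)
      (ψ : R₀ →+* Γ((O₀.1 : Scheme.{0}), (O₀.1.ι ≫ affineBlowup.π I6 ≫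
        Spec.map (CommRingCat.ofHom (algebraMap
          (FixedPoints.subalgebra k (MvPolynomial (Fin n) k) (Subgroup.zpowers σ))
          (MvPolynomial (Fin n) k)))) ⁻¹ᵁ ⊤)),
      Function.Injective ψ ∧ ψ.range = (ρB.restrict O₀.1 O₀.2.1).invariantsRing ⊤ ∧
      J₀.IsRadical ∧ Scheme.IsRegular (affineBlowup J₀) ∧
      ((Ideal.span ((O₀.1.ι.appLE Vu ((O₀.1.ι ≫ affineBlowup.π I6 ≫
          Spec.map (CommRingCat.ofHom (algebraMap
            (FixedPoints.subalgebra k (MvPolynomial (Fin n) k) (Subgroup.zpowers σ))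
            (MvPolynomial (Fin n) k)))) ⁻¹ᵁ ⊤) hle) ''
        (((affineBlowup.π I6).appLE ⊤ Vu hVu) '' (ι₀ '' ({X a, X b, X c} : Set (MvPolynomial (Fin n) k))) ∪
          Set.range T))).comap ψ).radical = J₀ := by
  classical
  haveI : Fact p.Prime := ⟨hp⟩
  let S : Type := MvPolynomial (Fin n) k
  let G : Type := ↥(Subgroup.zpowers σ)
  let g₀ : G := ⟨σ, Subgroup.mem_zpowers σ⟩
  have hπ : IsBlowup (affineBlowup.π I6) (affineBlowup.idealSheaf I6) := affineBlowup.isBlowup I6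
  have ha : σ (X a) = X a := hσ a hab hac had
  -- destructure the action and the open, so that `ρB.aut` and `O₀.1` become literal
  obtain ⟨aut, haut⟩ := ρB
  dsimp only at hρB
  subst hρB
  obtain ⟨O, hOst, hOaff⟩ := O₀
  dsimp only at hO₀
  subst hO₀
  dsimp only at hle ⊢
  -- the root-chart automorphism and the chart isomorphism (file 1/3)
  -- (never `obtain … := <term>` / `set` here: abstracting over this goal is prohibitively expensive)
  have hσUex := exists_rootChart4Equiv k n a b c d hab hac had hbc hbd hcd
  obtain ⟨σU, hUb, hUc, hUd, hσU⟩ := hσUex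
  have hUa : σU (X a) = X a := hσU a hab hac had
  have hσa2 : σ (X a ^ 2) = X a ^ 2 := by rw [map_pow σ (X a) 2, ha]
  have hXa6 : MvPolynomial.aeval root0 (X a ^ 2 : S) = X a ^ 6 := by
    rw [map_pow (MvPolynomial.aeval root0) (X a) 2, aeval_root0_X_a, ← pow_mul]
  have hΘex := exists_ringEquiv_blowupChart0_adjoin k n a b c hab hbc hac
  obtain ⟨Θ, hΘf, hΘT⟩ := hΘex
  have hroot := aeval_root0_comp_eq k n a b c d hab hac had hbc hbd hcd σ σU hb hc hd hσ hUb hUc hUd hσU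
  have hrootf : ∀ f : S, MvPolynomial.aeval root0 (σ f) = σU (MvPolynomial.aeval root0 f) := by
    intro f
    have h := AlgHom.congr_fun hroot f
    simp only [AlgHom.comp_apply, AlgEquiv.coe_toAlgHom] at h
    exact h
  -- `Γ(O₀) ≅ Γ(V, V[x_a²])`: the restriction along `V[x_a²] ↪ V` is `topIso.inv`
  have hι : (Vu).ι.appLE Vu ⊤ hle = (Vu).topIso.inv := ι_appLE_eq_topIso_inv Vu hle
  let E₀ : Γ((Vu : Scheme.{0}), ⊤) ≃+* Γ(affineBlowup I6, Vu) := (Vu).topIso.commRingCatIsoToRingEquiv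
  have hE₀ : ∀ t, E₀ ((Vu).ι.appLE Vu ⊤ hle t) = t := fun t => by
    rw [hι]; change ((Vu).topIso.inv ≫ (Vu).topIso.hom) t = t; rw [Iso.inv_hom_id]; rfl
  let E : Γ((Vu : Scheme.{0}), ⊤) ≃+* ↥S₀ := E₀.trans Θ
  have hE : ∀ t, E ((Vu).ι.appLE Vu ⊤ hle t) = Θ t := fun t => by
    change Θ (E₀ _) = Θ t; rw [hE₀]
  have hEsymm : ∀ t, E.symm (Θ t) = (Vu).ι.appLE Vu ⊤ hle t := fun t =>
    E.injective (by rw [E.apply_symm_apply, hE])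
  -- the action upstairs on pulled-back functions: `(ρ♯ g⁻¹)^* (π^* f) = π^*(g • f)`
  let ρV := hπ.liftAction ρ (idealSheaf_I6_comap k n σ a b c ha hb hc ρ hρ)
  have hst : ∀ g : G, (Vu) ≤ (ρV g).hom ⁻¹ᵁ Vu := fun g => (hOst g).ge
  have hpull : ∀ (g : G) (f : S), (ρV g⁻¹).hom.appLE Vu Vu (hst g⁻¹)
      ((affineBlowup.π I6).appLE ⊤ Vu hVu (ι₀ f)) =
      (affineBlowup.π I6).appLE ⊤ Vu hVu (ι₀ (g • f)) := by
    intro g f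
    rw [ToricExit.appLE_appLE_of_comp_eq (affineBlowup.π I6) (ρV g⁻¹).hom (ρ g⁻¹).hom
      (hπ.liftAction_hom_comp ρ _ g⁻¹) Vu (hst g⁻¹) hVu (ι₀ f)]
    have h := ToricExit.specAction_appTop_ΓSpecIso_inv_smul ρ hρ f g⁻¹
    rw [inv_inv] at h
    exact congrArg _ h
  let act : G → (Γ((Vu : Scheme.{0}), ⊤) →+* Γ((Vu : Scheme.{0}), ⊤)) := fun g =>
    (ActionOver.restrict ⟨ρV, haut⟩ Vu hOst).act g ⊤
  have hact : ∀ (g : G) (t : Γ(affineBlowup I6, Vu)),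
      act g ((Vu).ι.appLE Vu ⊤ hle t) = (Vu).ι.appLE Vu ⊤ hle ((ρV g⁻¹).hom.appLE Vu Vu (hst g⁻¹) t) :=
    fun g t => act_restrict_ι_appLE ⟨ρV, haut⟩ Vu hOst hOaff g t hle (hst g⁻¹)
  have hsmul : ∀ f : S, g₀ • f = σ f := fun f => rfl
  have hEf : ∀ f : S, ((E (act g₀ ((Vu).ι.appLE Vu ⊤ hle ((affineBlowup.π I6).appLE ⊤ Vu hVu (ι₀ f))))
      : ↥S₀) : S) = σU (MvPolynomial.aeval root0 f) := by
    intro f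
    rw [hact, hpull, hE, hsmul, hΘf, hrootf]
  have hET : ∀ j : {j : Fin 8 // j ≠ 0}, ((E (act g₀ ((Vu).ι.appLE Vu ⊤ hle (T j))) : ↥S₀) : S) =
      σU (q8 j.1) := by
    intro j
    rw [hact, hE]
    have h1 := congrArg ((ρV g₀⁻¹).hom.appLE Vu Vu (hst g₀⁻¹)) (hT j)
    simp only [map_mul] at h1
    rw [hpull, hpull, hsmul, hsmul, hσa2] at h1
    have h2 := congrArg (fun z => ((Θ z : ↥S₀) : S)) h1
    simp only [map_mul, Subalgebra.coe_mul] at h2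
    rw [hΘf, hΘf, hrootf, aeval_root0_I6 k n a b c hab hbc hac, hXa6, map_mul, map_pow σU (X a) 6,
      hUa, mul_comm] at h2
    exact (mul_left_cancel₀ (pow_ne_zero 6 (X_ne_zero a)) h2).symm
  -- EQUIVARIANCE everywhere: `E ∘ act σ = σ_U ∘ E`
  have hEact : ∀ x : Γ((Vu : Scheme.{0}), ⊤), ((E (act g₀ x) : ↥S₀) : S) = σU ((E x : ↥S₀) : S) := by
    intro x
    suffices key : ∀ (f : S), f ∈ S₀ → ∀ (hf : f ∈ S₀),
        ((E (act g₀ (E.symm ⟨f, hf⟩)) : ↥S₀) : S) = σU f by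
      have := key ((E x : ↥S₀) : S) (E x).2 (E x).2
      rw [Subtype.coe_eta, E.symm_apply_apply] at this
      exact this
    intro f hf₀
    induction hf₀ using Algebra.adjoin_induction with
    | mem f hf =>
      intro hf'
      rcases hf with ⟨s, rfl⟩ | ⟨j, rfl⟩
      · -- `f = ψ₀(x_s) = Θ (π^* x_s)`
        have hval : E.symm ⟨MvPolynomial.aeval root0 (X s : S), hf'⟩ =
            (Vu).ι.appLE Vu ⊤ hle ((affineBlowup.π I6).appLE ⊤ Vu hVu (ι₀ (X s))) := by
          rw [← hEsymm]; congr 1; exact Subtype.ext (hΘf (X s)).symm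
        change ((E (act g₀ (E.symm ⟨MvPolynomial.aeval root0 (X s : S), hf'⟩)) : ↥S₀) : S) = _
        rw [hval, hEf]
      · -- `f = q_j`
        by_cases hj : j = 0
        · subst hj
          have h1 : (⟨(q8 0 : S), hf'⟩ : ↥S₀) = 1 := Subtype.ext (by simp)
          change ((E (act g₀ (E.symm ⟨(q8 0 : S), hf'⟩)) : ↥S₀) : S) = σU (q8 0)
          rw [h1, map_one, map_one, map_one]
          simp
        · have hval : E.symm ⟨q8 j, hf'⟩ = (Vu).ι.appLE Vu ⊤ hle (T ⟨j, hj⟩) := by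
            rw [← hEsymm]; congr 1; exact Subtype.ext (hΘT j (T ⟨j, hj⟩) (hT ⟨j, hj⟩)).symm
          change ((E (act g₀ (E.symm ⟨(q8 j : S), hf'⟩)) : ↥S₀) : S) = σU (q8 j)
          rw [hval, hET]
    | algebraMap r =>
      intro hf'
      have hval : E.symm ⟨algebraMap k S r, hf'⟩ =
          (Vu).ι.appLE Vu ⊤ hle ((affineBlowup.π I6).appLE ⊤ Vu hVu (ι₀ (C r))) := by
        rw [← hEsymm]; congr 1
        refine Subtype.ext ?_
        rw [hΘf, MvPolynomial.algHom_C]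
      rw [hval, hEf, MvPolynomial.algHom_C]
    | add f g hf hg ihf ihg =>
      intro hfg
      have h1 : (⟨f + g, hfg⟩ : ↥S₀) = ⟨f, hf⟩ + ⟨g, hg⟩ :=
        Subtype.ext (by simp only [Subalgebra.coe_add])
      rw [h1, map_add, map_add, map_add, Subalgebra.coe_add, ihf hf, ihg hg, map_add]
    | mul f g hf hg ihf ihg =>
      intro hfg
      have h1 : (⟨f * g, hfg⟩ : ↥S₀) = ⟨f, hf⟩ * ⟨g, hg⟩ :=
        Subtype.ext (by simp only [Subalgebra.coe_mul])
      rw [h1, map_mul, map_mul, map_mul, Subalgebra.coe_mul, ihf hf, ihg hg, map_mul]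
  -- INVARIANTS of the cyclic group = fixed points of the generator
  have hInv : ∀ x : Γ((Vu : Scheme.{0}), ⊤),
      x ∈ (ActionOver.restrict ⟨ρV, haut⟩ Vu hOst).invariantsRing ⊤ ↔ act g₀ x = x := by
    intro x
    constructor
    · intro h
      exact (ActionOver.mem_invariantsRing_iff (ActionOver.restrict ⟨ρV, haut⟩ Vu hOst) ⊤ x).mp h g₀
    · intro h
      refine (ActionOver.mem_invariantsRing_iff (ActionOver.restrict ⟨ρV, haut⟩ Vu hOst) ⊤ x).mpr
        fun g => ?_
      letI : MulSemiringAction G Γ((Vu : Scheme.{0}), ⊤) :=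
        (ActionOver.restrict ⟨ρV, haut⟩ Vu hOst).mulSemiringAction ⊤
      have hz := exists_eq_generator_zpow σ g
      obtain ⟨z, rfl⟩ := hz
      have hx : x ∈ MulAction.fixedBy Γ((Vu : Scheme.{0}), ⊤) g₀ := h
      exact MulAction.fixedBy_subset_fixedBy_zpow Γ((Vu : Scheme.{0}), ⊤) g₀ z hx
  have hInv' : ∀ x : Γ((Vu : Scheme.{0}), ⊤),
      x ∈ (ActionOver.restrict ⟨ρV, haut⟩ Vu hOst).invariantsRing ⊤ ↔
        σU ((E x : ↥S₀) : S) = (E x : S) := by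
    intro x
    refine (hInv x).trans ⟨fun h => ?_, fun h => ?_⟩
    · have h1 := hEact x
      rw [h] at h1
      exact h1.symm
    · exact E.injective (Subtype.ext ((hEact x).trans h))
  -- the equations `𝔞` and their images `𝔟 = E(𝔞) ⊆ S₀`, with values in `(x_a, x_b, x_c)`
  let M : Ideal S := Ideal.span ({X a, X b, X c} : Set S)
  haveI : M.IsPrime := isPrime_span_X_three k n a b c
  have hXa : (X a : S) ∈ M := Ideal.subset_span (by simp)
  have hXb : (X b : S) ∈ M := Ideal.subset_span (by simp)
  have hXc : (X c : S) ∈ M := Ideal.subset_span (by simp)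
  let 𝔞 : Set Γ((Vu : Scheme.{0}), ⊤) := ((Vu).ι.appLE Vu ⊤ hle) ''
    (((affineBlowup.π I6).appLE ⊤ Vu hVu) '' (ι₀ '' ({X a, X b, X c} : Set S)) ∪ Set.range T)
  have h𝔟M : ∀ z ∈ E '' 𝔞, algebraMap (↥S₀) S z ∈ M := by
    rintro _ ⟨w, hw, rfl⟩
    obtain ⟨v, hv, rfl⟩ := hw
    rw [hE]
    change ((Θ v : ↥S₀) : S) ∈ M
    rcases hv with ⟨u, ⟨f, hf, rfl⟩, rfl⟩ | ⟨j, rfl⟩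
    · rw [hΘf]
      simp only [Set.mem_insert_iff, Set.mem_singleton_iff] at hf
      rcases hf with rfl | rfl | rfl
      · rw [aeval_root0_X_a]; exact M.pow_mem_of_mem hXa 3 three_pos
      · rw [aeval_root0_X_b k n a b c hab]; exact M.mul_mem_right _ hXb
      · rw [aeval_root0_X_c k n a b c hac hbc]; exact M.mul_mem_right _ hXc
    · rw [hΘT j.1 (T j) (hT j)]
      exact q8_mem_span_X k n a b c j.1 j.2
  have hM𝔟 : M ≤ ((Ideal.span (E '' 𝔞)).map (algebraMap (↥S₀) S)).radical := by
    have hgen : ∀ (v : Γ(affineBlowup I6, Vu)),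
        v ∈ ((affineBlowup.π I6).appLE ⊤ Vu hVu) '' (ι₀ '' ({X a, X b, X c} : Set S)) ∪ Set.range T →
        ((Θ v : ↥S₀) : S) ∈ (Ideal.span (E '' 𝔞)).map (algebraMap (↥S₀) S) := by
      intro v hv
      have h1 : E ((Vu).ι.appLE Vu ⊤ hle v) ∈ Ideal.span (E '' 𝔞) :=
        Ideal.subset_span ⟨_, ⟨v, hv, rfl⟩, rfl⟩
      rw [hE] at h1
      exact Ideal.mem_map_of_mem _ h1
    have h3 : (X a : S) ^ 3 ∈ (Ideal.span (E '' 𝔞)).map (algebraMap (↥S₀) S) := by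
      have := hgen _ (Set.mem_union_left _ ⟨ι₀ (X a), ⟨X a, by simp, rfl⟩, rfl⟩)
      rwa [hΘf, aeval_root0_X_a] at this
    have h4 : (X b : S) ^ 3 ∈ (Ideal.span (E '' 𝔞)).map (algebraMap (↥S₀) S) := by
      have := hgen _ (Set.mem_union_right _ ⟨⟨4, by decide⟩, rfl⟩)
      rwa [hΘT 4 (T ⟨4, by decide⟩) (hT ⟨4, by decide⟩)] at this
    have h5 : (X c : S) ^ 3 ∈ (Ideal.span (E '' 𝔞)).map (algebraMap (↥S₀) S) := by
      have := hgen _ (Set.mem_union_right _ ⟨⟨3, by decide⟩, rfl⟩)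
      rwa [hΘT 3 (T ⟨3, by decide⟩) (hT ⟨3, by decide⟩)] at this
    change Ideal.span ({X a, X b, X c} : Set S) ≤ _
    rw [Ideal.span_le]
    intro x hx
    simp only [Set.mem_insert_iff, Set.mem_singleton_iff] at hx
    rcases hx with rfl | rfl | rfl
    exacts [⟨3, h3⟩, ⟨3, h4⟩, ⟨3, h5⟩]
  haveI := isIntegral_adjoin_chart0 k n a b c hab hbc hac
  have hrad𝔟 : (Ideal.span (E '' 𝔞)).radical = M.comap (algebraMap (↥S₀) S) :=
    radical_span_eq_comap_of_isIntegral (fun x y h => Subtype.ext h) M (E '' 𝔞) h𝔟M hM𝔟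
  have hp3 : p % 3 = 1 ∨ p % 3 = 2 := by
    have h0 : p % 3 ≠ 0 := fun h0 => by
      rcases (Nat.dvd_prime hp).mp (Nat.dvd_of_mod_eq_zero h0) with h | h <;> omega
    omega
  -- THE FINISH, uniform in the presentation
  have finish : ∀ (pres : MvPolynomial (Fin n ⊕ Fin 4) k →ₐ[k] S)
      (gens7 : Fin 7 → MvPolynomial (Fin n ⊕ Fin 4) k)
      (hfix : {f : S | f ∈ S₀ ∧ σU f = f} = ((pres.range.map (subst0 k n a b c d p)) : Set S))
      (hrad : (Ideal.span (Set.range (fun l : Fin 7 =>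
        Ideal.Quotient.mk (RingHom.ker pres) (gens7 l)))).IsRadical)
      (hreg : Scheme.IsRegular (affineBlowup (Ideal.span (Set.range (fun l : Fin 7 =>
        Ideal.Quotient.mk (RingHom.ker pres) (gens7 l))))))
      (hcomap : M.comap ((subst0 k n a b c d p : S →+* S).comp
          (Ideal.Quotient.lift (RingHom.ker pres.toRingHom) pres.toRingHom fun _ h => h)) =
        Ideal.span (Set.range (fun l : Fin 7 => Ideal.Quotient.mk (RingHom.ker pres) (gens7 l)))),
      ∃ (R₀ : Type) (_ : CommRing R₀) (J₀ : Ideal R₀) (ψ : R₀ →+* Γ((Vu : Scheme.{0}), ⊤)),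
        Function.Injective ψ ∧ ψ.range = (ActionOver.restrict ⟨ρV, haut⟩ Vu hOst).invariantsRing ⊤ ∧
        J₀.IsRadical ∧ Scheme.IsRegular (affineBlowup J₀) ∧
        ((Ideal.span 𝔞).comap ψ).radical = J₀ := by
    intro pres gens7 hfix hrad hreg hcomap
    let lift : (MvPolynomial (Fin n ⊕ Fin 4) k ⧸ RingHom.ker pres.toRingHom) →+* S :=
      Ideal.Quotient.lift (RingHom.ker pres.toRingHom) pres.toRingHom fun _ h => h
    have hlift_inj : Function.Injective lift :=
      RingHom.lift_injective_of_ker_le_ideal _ (fun _ h => h) le_rfl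
    have hlift_mk : ∀ y, lift (Ideal.Quotient.mk _ y) = pres y := fun y => rfl
    have hmemψ : ∀ x, subst0 k n a b c d p (lift x) ∈ {f : S | f ∈ S₀ ∧ σU f = f} := by
      intro x
      have hy := Ideal.Quotient.mk_surjective x
      obtain ⟨y, rfl⟩ := hy
      rw [hfix, hlift_mk]
      exact Subalgebra.mem_map.mpr ⟨pres y, ⟨y, rfl⟩, rfl⟩
    let ψ' : (MvPolynomial (Fin n ⊕ Fin 4) k ⧸ RingHom.ker pres.toRingHom) →+* ↥S₀ :=
      ((subst0 k n a b c d p : S →+* S).comp lift).codRestrict S₀ fun x => (hmemψ x).1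
    have hψ'val : ∀ x, ((ψ' x : ↥S₀) : S) = subst0 k n a b c d p (lift x) := fun x => rfl
    let ψ : (MvPolynomial (Fin n ⊕ Fin 4) k ⧸ RingHom.ker pres.toRingHom) →+* Γ((Vu : Scheme.{0}), ⊤) :=
      (E.symm : ↥S₀ →+* Γ((Vu : Scheme.{0}), ⊤)).comp ψ'
    have hψ : ∀ x, E (ψ x) = ψ' x := fun x => E.apply_symm_apply _
    refine ⟨_, inferInstance, _, ψ, ?_, ?_, hrad, hreg, ?_⟩
    · -- injective
      intro x y hxy
      have h1 : ψ' x = ψ' y := by rw [← hψ, ← hψ, hxy]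
      have h2 := congrArg (fun z : ↥S₀ => (z : S)) h1
      simp only [hψ'val] at h2
      exact hlift_inj (subst0_injective k n a b c d p hab hbc hbd hcd hp hp5 h2)
    · -- range = invariants
      ext x
      constructor
      · rintro ⟨r, rfl⟩
        refine (hInv' _).mpr ?_
        rw [hψ, hψ'val]
        exact (hmemψ r).2
      · intro hx
        have hx1 := (hInv' x).mp hx
        have hx' : ((E x : ↥S₀) : S) ∈ {f : S | f ∈ S₀ ∧ σU f = f} := ⟨(E x).2, hx1⟩
        rw [hfix] at hx'
        have hx'' := Subalgebra.mem_map.mp hx'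
        obtain ⟨_, ⟨y, rfl⟩, hy⟩ := hx''
        refine ⟨Ideal.Quotient.mk _ y, ?_⟩
        apply E.injective
        rw [hψ]
        exact Subtype.ext (by rw [hψ'val, hlift_mk]; exact hy)
    · -- the radical identity
      have h1 : (Ideal.span 𝔞).comap ψ = (Ideal.span (E '' 𝔞)).comap ψ' := by
        change (Ideal.span 𝔞).comap ((E.symm : ↥S₀ →+* Γ((Vu : Scheme.{0}), ⊤)).comp ψ') = _
        rw [← Ideal.comap_comap]
        congr 1
        change (Ideal.span 𝔞).comap E.symm = _
        rw [Ideal.comap_symm, Ideal.map_span]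
      rw [h1, ← Ideal.comap_radical, hrad𝔟, Ideal.comap_comap]
      have h2 : (algebraMap (↥S₀) S).comp ψ' = (subst0 k n a b c d p : S →+* S).comp lift :=
        RingHom.ext fun x => rfl
      rw [h2]
      exact hcomap
  rcases hp3 with hp3 | hp3
  · exact finish (Third112.presentation k n a b c) (Third112.gens k n a b c)
      (chart0_fixedPoints_eq_map_subst0_of_mod_three_eq_one k n σU a b c d hab hac had hbc hbd hcd
        hUb hUc hUd hσU p hp hp5 hp3)
      (Third112.span_gens_isRadical k n a b c)
      (Third112.blowup_regular k n a b c hab hbc hac).1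
      (comap_subst0_lift_span_X_eq k n a b c d p hp.pos hab hac hbc hbd hcd)
  · exact finish (Third112.presentation k n b c a) (Third112.gens k n b c a)
      (chart0_fixedPoints_eq_map_subst0_of_mod_three_eq_two k n σU a b c d hab hac had hbc hbd hcd
        hUb hUc hUd hσU p hp hp5 hp3)
      (Third112.span_gens_isRadical k n b c a)
      (Third112.blowup_regular k n b c a hbc (Ne.symm hac) (Ne.symm hab)).1
      (comap_subst0_lift_span_X_eq' k n a b c d p hp.pos hab hac hbc hbd hcd)

end Chart0

end Summit.ResolutionOfSingularities.ResolutionOfSingularities.Theorems.WildQuotientResolution.JordanFour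

end
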